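/-
Copyright: cell pub-balaban-gaps, seat ne8 (estimate NE7c), gen 17. Project licence.
-/
import Summits.QuantumFields.BalabanUV.T4Continuum.Spine.NE7c.LiveFactorSUNCentralTube
import Summits.QuantumFields.BalabanUV.T4Continuum.Spine.NE7c.LiveFactorSUNTubeChart
import Summits.QuantumFields.BalabanUV.T4Continuum.Spine.NE7c.LiveFactorWindowTightSUN
import Literature.MathematicalPhysics.QuantumFieldTheory.UnitaryHaarVolume

/-!
# THE SMALL-BALL CONSTANT OF `SU(N)` VALUED FOR EVERY `N ≥ 2`: `Haar_{SU(N)}{‖V − 1‖_HS ≤ η} ∕ η^{N²−1} → C₀(N)`,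
# `C₀(N) = c_N · (2π∕√N) · ω_{N²−1} = ∏_{j<N} j! ∕ (2π)^{N(N+1)∕2} · 2π∕√N · (√π)^{N²−1}∕Γ((N²−1)∕2 + 1)` — step B3 of HANDOFF § GEN 16 open point (vi′)
# (row NE7c; the existential constant of this seat's file 36 `exists_tendsto_haar_sball_div_pow`, consumed BY NAME by ne6's J4, is now a NUMBER; [folklore])

Cell `pub-balaban-gaps` (G2), seat ne8, estimate **NE7c**.  Proof-only file under `Spine/NE7c/`: imports this seat's files 40 `LiveFactorSUNCentralTube` (B0: `SU(N)` ball =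
`m` central tube segments of `U(N)`), `LiveFactorSUNTubeChart` (B1b: tube segment squeezed between solid cylinders in the Cayley chart; over `LiveFactorSUNTubeCoords`, B1a),
41 `LiveFactorCylinderVolume` (B2: volume of a solid cylinder), 36 `LiveFactorWindowTightSUN` (the constant EXISTS), and the tree's `UnitaryHaarVolume` (the `U(N)` density
`c_N = haarChartConst N = ∏_{j<N} j!∕(2π)^{N(N+1)∕2}` VALUED; `UnitaryCayleyChart.chartMeasure_le` ∕ `le_chartMeasure_of_subset`), all BY NAME.  No `def`; 0 `sorry`.

THE ARGUMENT ([folklore]; equivalently `vol_HS SU(N) = √N·(2π)^{(N²+N−2)∕2}∕∏_{j<N} j!`, Macdonald 1980, from `vol_HS U(N)` by the `N`-fold cover `SU(N) × U(1) → U(N)`):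
along `η_j = 1∕j`, B0 with `m = j` gives `Haar_{SU(N)}(SB(1∕j)) = j · Haar_{U(N)} P(1∕j, π∕j)`; B1b squeezes `P` between the chart images of the cylinders
`Cyl((1 ± ε′)∕j, (π∕N ± ε′)-arcs∕j)`, whose Haar masses are squeezed by `c_N·(1 ± o(1))·vol` (`chartMeasure_le`, `le_chartMeasure_of_subset` with `κ(r) → 1`) and whose
volumes are `√N·|J|·ω_{N²−1}·ρ^{N²−1}` (B2 with `e = d∕√N`, `⟪x, e⟫ = √N·τ x`); so `j^{N²−1}·Haar_{SU(N)}(SB(1∕j))` is squeezed between `c_N·2√N(π∕N ∓ ε″)ω(1 ∓ ε″)^{N²−1}`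
for every `ε″ > 0` and `j` large, while it converges to file 36's `C₀` — hence `C₀ = c_N · 2π ω_{N²−1} ∕ √N`.
* (B1b §6: the cylinders of B1 in the form of B2, `volume_cylinder_toReal`, `cylinder_subset_closedBall`);
* §2 the sequence `j ↦ Haar(SB(1∕j))·j^{N²−1}` and its limit `C₀` (`tendsto_seq_of_tendsto`);
* §3 UPPER and §4 LOWER eventual bounds (`seq_le_eventually`, `le_seq_eventually`);
* §5 **`tendsto_haar_sball_div_pow_const`** (`→ c_N·(2π∕√N)·ω_{N²−1}`), **`haar_sball_const_eq`** (any limit `C₀` equals it), **`tendsto_haar_sball_div_pow_valued`**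
  (closed form via `UnitaryColumn.haarChartConst_eq`), the `N = 2` cross-check `const_two_eq` (`= 1∕(3√2·π)`, file 36's `asymptotic_const_SU2_eq`) and the
  `SU(3)` value `const_three_eq` (`= 1∕(384·√3·π)`).

HONEST: Haar-measure asymptotics of the compact group `SU(N)` ([folklore]); nothing of the interacting measure, nothing of Bałaban's; census-neutral for road (δ) (ratios only) — it
VALUES the constant of ne6's all-`N` one-plaquette law (`CompactFibrePlaquetteMassSUNConstant`).  NE7c NOT proved; WORD UNCHANGED (WORK-bound behind node O; INSTANCE 0∕1); spine 0∕9;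
one finite T⁴ — NOT ℝ⁴, NOT infinite volume, NOT the mass gap, NOT Clay.
-/

set_option autoImplicit false

noncomputable section

open scoped Matrix.Norms.Frobenius Real Topology ENNReal
open MeasureTheory Set Filter Complex Metric
open Literature.MathematicalPhysics.QuantumFieldTheory (haarProbability)
open Literature.MathematicalPhysics.QuantumFieldTheory.UnitaryCayley (𝔼 𝔾 skewOf unskew chart chartMeasure chartMeasure_apply haarChartConst chartMeasure_le
  le_chartMeasure_of_subset lowerConst κ κ_pos continuous_κ κ_zero finrank_𝔼)
open Literature.MathematicalPhysics.QuantumFieldTheory.UnitaryColumn (haarChartConst_eq)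
open Literature.RepresentationTheory.CompactGroups.WeylIntegration (specialPart)
open Summit.Ventures.LatticeQCDFlow.Theory2.Lattice.SUN (imTrace)
open Summit.QuantumFields.BalabanUV.T4Continuum.Spine.NE7c.LiveFactorSUNCentralTube (haar_sball_eq_mul_haar_centredTube)
open Summit.QuantumFields.BalabanUV.T4Continuum.Spine.NE7c.LiveFactorSUNTubeChart (tube_subset_chart_image_cylinder chart_image_cylinder_subset_tube
  volume_cylinder_toReal cylinder_subset_closedBall mem_Icc_iff_sqrt_mul mem_Ioc_iff_sqrt_mul)
open Summit.QuantumFields.BalabanUV.T4Continuum.Spine.NE7c.LiveFactorWindowTightSUN (exists_tendsto_haar_sball_div_pow)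

namespace Summit.QuantumFields.BalabanUV.T4Continuum.Spine.NE7c.LiveFactorSUNSmallBallConstant

variable {N : ℕ}

/-! ## §2 The sequence `a_j = Haar_{SU(N)}(SB(1∕j)) · j^{N²−1}` and the limit of file 36 along it -/

/-- the existential constant of file 36 is the limit of `a_j`. [folklore] -/
theorem tendsto_seq_of_tendsto {C₀ : ℝ}
    (h : Tendsto (fun η : ℝ => (haarProbability (Matrix.specialUnitaryGroup (Fin N) ℂ)).real
      {V : Matrix.specialUnitaryGroup (Fin N) ℂ | ‖(V : Matrix (Fin N) (Fin N) ℂ) - 1‖ ≤ η} / η ^ (N ^ 2 - 1)) (𝓝[>] 0) (𝓝 C₀)) :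
    Tendsto (fun j : ℕ => (haarProbability (Matrix.specialUnitaryGroup (Fin N) ℂ)).real
      {V : Matrix.specialUnitaryGroup (Fin N) ℂ | ‖(V : Matrix (Fin N) (Fin N) ℂ) - 1‖ ≤ (j : ℝ)⁻¹} * (j : ℝ) ^ (N ^ 2 - 1)) atTop (𝓝 C₀) := by
  have hseq : Tendsto (fun j : ℕ => ((j : ℝ))⁻¹) atTop (𝓝[>] 0) := tendsto_inv_atTop_nhdsGT_zero.comp tendsto_natCast_atTop_atTop
  refine (h.comp hseq).congr' ?_
  filter_upwards [eventually_gt_atTop 0] with j hj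
  have hj' : (0 : ℝ) < j := Nat.cast_pos.2 hj
  simp only [Function.comp_apply, inv_pow, div_eq_mul_inv, inv_inv]

/-! ## §3 UPPER: `a_j ≤ c_N · 2√N (π∕N + ε(1+π)) · (1 + ε(1+π))^{N²−1} · ω` eventually -/

/-- **THE UPPER BOUND ALONG THE SEQUENCE** (`N ≥ 2`): for every `ε > 0`, eventually in `j`,
`a_j ≤ c_N · (2√N (π∕N + ε(1+π))) · (1 + ε(1+π))^{N²−1} · (√π)^{N²−1}∕Γ((N²−1)∕2+1)`. [folklore] -/
theorem seq_le_eventually (hN : 2 ≤ N) {ε : ℝ} (hε : 0 < ε) :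
    ∀ᶠ j : ℕ in atTop, (haarProbability (Matrix.specialUnitaryGroup (Fin N) ℂ)).real
        {V : Matrix.specialUnitaryGroup (Fin N) ℂ | ‖(V : Matrix (Fin N) (Fin N) ℂ) - 1‖ ≤ (j : ℝ)⁻¹} * (j : ℝ) ^ (N ^ 2 - 1)
      ≤ (haarChartConst N : ℝ) * (2 * Real.sqrt N * (π / N + ε * (1 + π))) *
          ((1 + ε * (1 + π)) ^ (N * N - 1) * (Real.sqrt π ^ (N * N - 1) / Real.Gamma ((N * N - 1 : ℕ) / 2 + 1))) := by
  haveI : NeZero N := ⟨by omega⟩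
  have hN0 : (0 : ℝ) < N := Nat.cast_pos.2 (Nat.pos_of_ne_zero (NeZero.ne N))
  have hsN : 0 < Real.sqrt N := Real.sqrt_pos.2 hN0
  obtain ⟨δ₀, hδ₀, hout⟩ := tube_subset_chart_image_cylinder (N := N) hε
  -- `j ≥ j₀` with `(1 + π)/j ≤ δ₀`
  obtain ⟨j₀, hj₀⟩ := exists_nat_gt ((1 + π) / δ₀)
  filter_upwards [eventually_ge_atTop j₀, eventually_gt_atTop 0] with j hj hjpos
  have hjr : (0 : ℝ) < j := Nat.cast_pos.2 hjpos
  set δ : ℝ := (j : ℝ)⁻¹ with hδ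
  set t : ℝ := π / j with ht
  have hδpos : 0 < δ := by rw [hδ]; positivity
  have htnn : 0 ≤ t := by rw [ht]; positivity
  have hR : δ + t = (1 + π) / j := by rw [hδ, ht]; field_simp
  have hRδ₀ : δ + t ≤ δ₀ := by
    rw [hR, div_le_iff₀ hjr]
    have h1 : (1 + π) / δ₀ < j := lt_of_lt_of_le hj₀ (by exact_mod_cast hj)
    rw [div_lt_iff₀ hδ₀] at h1
    linarith
  -- B0: `Haar(SB δ) = j · Haar(P(δ, π/j))`
  have hB0 := haar_sball_eq_mul_haar_centredTube (N := N) hjpos δ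
  have htj : π / (j : ℝ) = t := rfl
  -- the tube lies in the chart image of the thickened cylinder
  have hsub := hout δ t hδpos htnn hRδ₀
  rw [htj] at hB0
  -- measure chain in `ℝ≥0∞`
  set Cyl := {x : 𝔼 N | ‖x - (imTrace N x / N) • unskew ((I : ℂ) • (1 : Matrix (Fin N) (Fin N) ℂ))‖ ≤ δ + ε * (δ + t) ∧
      imTrace N x / N ∈ Set.Icc (-(t / N) - ε * (δ + t)) (t / N + ε * (δ + t))} with hCyl
  have hchain : haarProbability (𝔾 N) {u : 𝔾 N |
        ‖((specialPart u : Matrix.specialUnitaryGroup (Fin N) ℂ) : Matrix (Fin N) (Fin N) ℂ) - 1‖ ≤ δ ∧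
          arg (u : Matrix (Fin N) (Fin N) ℂ).det ∈ Set.Ioc (-t) t}
      ≤ haarChartConst N * volume Cyl :=
    calc _ ≤ haarProbability (𝔾 N) (chart '' Cyl) := measure_mono hsub
      _ = chartMeasure N Cyl := (chartMeasure_apply Cyl).symm
      _ ≤ haarChartConst N * volume Cyl := chartMeasure_le Cyl
  -- the volume of the thickened cylinder, real form
  have hρ : 0 ≤ δ + ε * (δ + t) := by positivity
  have hvol := volume_cylinder_toReal (N := N) hN hρ (J' := Icc (Real.sqrt N * (-(t / N) - ε * (δ + t))) (Real.sqrt N * (t / N + ε * (δ + t))))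
    (fun s => mem_Icc_iff_sqrt_mul _ _ s) measurableSet_Icc
  have hlen0 : 0 ≤ Real.sqrt N * (t / N + ε * (δ + t)) - Real.sqrt N * (-(t / N) - ε * (δ + t)) := by
    rw [← mul_sub]
    have h1 : 0 ≤ t / N := div_nonneg htnn hN0.le
    have h2 : 0 ≤ ε * (δ + t) := by positivity
    exact mul_nonneg hsN.le (by linarith)
  rw [Real.volume_Icc, ENNReal.toReal_ofReal hlen0] at hvol
  -- pass to reals
  have hfin : haarChartConst N * volume Cyl ≠ ∞ := by
    refine ENNReal.mul_ne_top ENNReal.coe_ne_top ?_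
    have hsub2 := cylinder_subset_closedBall (N := N) (ρ := δ + ε * (δ + t)) (T := t / N + ε * (δ + t))
      (J := Icc (-(t / N) - ε * (δ + t)) (t / N + ε * (δ + t))) (fun s hs => abs_le.2 ⟨by linarith [hs.1], hs.2⟩)
    exact (lt_of_le_of_lt (measure_mono hsub2) measure_closedBall_lt_top).ne
  have hreal : (haarProbability (𝔾 N) {u : 𝔾 N |
        ‖((specialPart u : Matrix.specialUnitaryGroup (Fin N) ℂ) : Matrix (Fin N) (Fin N) ℂ) - 1‖ ≤ δ ∧
          arg (u : Matrix (Fin N) (Fin N) ℂ).det ∈ Set.Ioc (-t) t}).toReal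
      ≤ (haarChartConst N : ℝ) * (volume Cyl).toReal := by
    have := ENNReal.toReal_mono hfin hchain
    rwa [ENNReal.toReal_mul, ENNReal.coe_toReal] at this
  rw [hvol] at hreal
  -- assemble: `a_j = j · Haar(P) · j^{n}`
  rw [measureReal_def, hB0, ENNReal.toReal_mul, ENNReal.toReal_natCast]
  have hn : N ^ 2 - 1 = N * N - 1 := by rw [sq]
  rw [hn]
  -- `j · X · j^n ≤ j · (c · (√N(len) · ((δ + εR)^n ω))) · j^n` and simplify using `δ = 1/j`, `t = π/j`
  have hlen : Real.sqrt N * (t / N + ε * (δ + t)) - Real.sqrt N * (-(t / N) - ε * (δ + t)) = 2 * Real.sqrt N * (π / N + ε * (1 + π)) / j := by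
    rw [ht, hδ]; field_simp; ring
  have hρj : δ + ε * (δ + t) = (1 + ε * (1 + π)) / j := by rw [hδ, ht]; field_simp
  rw [hlen, hρj, div_pow] at hreal
  have hjn : (0 : ℝ) < (j : ℝ) ^ (N * N - 1) := pow_pos hjr _
  calc (j : ℝ) * (haarProbability (𝔾 N) {u : 𝔾 N |
          ‖((specialPart u : Matrix.specialUnitaryGroup (Fin N) ℂ) : Matrix (Fin N) (Fin N) ℂ) - 1‖ ≤ δ ∧
            arg (u : Matrix (Fin N) (Fin N) ℂ).det ∈ Set.Ioc (-t) t}).toReal * (j : ℝ) ^ (N * N - 1)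
      ≤ (j : ℝ) * ((haarChartConst N : ℝ) * (2 * Real.sqrt N * (π / N + ε * (1 + π)) / j *
          ((1 + ε * (1 + π)) ^ (N * N - 1) / (j : ℝ) ^ (N * N - 1) * (Real.sqrt π ^ (N * N - 1) / Real.Gamma ((N * N - 1 : ℕ) / 2 + 1))))) *
          (j : ℝ) ^ (N * N - 1) := by gcongr
    _ = (haarChartConst N : ℝ) * (2 * Real.sqrt N * (π / N + ε * (1 + π))) *
          ((1 + ε * (1 + π)) ^ (N * N - 1) * (Real.sqrt π ^ (N * N - 1) / Real.Gamma ((N * N - 1 : ℕ) / 2 + 1))) := by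
        field_simp

/-! ## §4 LOWER: `a_j ≥ (c_N∕(1+η)) · 2√N (π∕N − ε(1+π)) · (1 − ε(1+π))^{N²−1} · ω` eventually -/

/-- the Cayley-chart density constant tends to `c_N` on small balls: `κ(r)^{N²} ≤ 1 + η` for `0 ≤ r ≤ r₀(η)`. [folklore] -/
theorem exists_kappa_pow_le {η : ℝ} (hη : 0 < η) : ∃ r₀ : ℝ, 0 < r₀ ∧ ∀ r : ℝ, 0 ≤ r → r ≤ r₀ → κ r ^ (N * N) ≤ 1 + η := by
  have hc : ContinuousAt (fun r : ℝ => κ r ^ (N * N)) 0 := ((continuous_κ.pow (N * N)).continuousAt)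
  obtain ⟨s, hs, h⟩ := (Metric.continuousAt_iff.1 hc) η hη
  refine ⟨s / 2, by positivity, fun r hr0 hrs => ?_⟩
  have := h (x := r) (by rw [Real.dist_eq, sub_zero, abs_of_nonneg hr0]; linarith)
  rw [Real.dist_eq, κ_zero, one_pow] at this
  linarith [(abs_lt.1 this).2]

/-- **THE LOWER BOUND ALONG THE SEQUENCE** (`N ≥ 2`; `ε(1+π) ≤ 1`, `ε(1+π) < π∕N`; density slack `η > 0`): eventually in `j`,
`a_j ≥ (c_N∕(1+η)) · (2√N (π∕N − ε(1+π))) · (1 − ε(1+π))^{N²−1} · (√π)^{N²−1}∕Γ((N²−1)∕2+1)`. [folklore] -/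
theorem le_seq_eventually (hN : 2 ≤ N) {ε η : ℝ} (hε : 0 < ε) (hε1 : ε * (1 + π) ≤ 1) (hε2 : ε * (1 + π) < π / N) (hη : 0 < η) :
    ∀ᶠ j : ℕ in atTop, (haarChartConst N : ℝ) / (1 + η) * (2 * Real.sqrt N * (π / N - ε * (1 + π))) *
          ((1 - ε * (1 + π)) ^ (N * N - 1) * (Real.sqrt π ^ (N * N - 1) / Real.Gamma ((N * N - 1 : ℕ) / 2 + 1)))
      ≤ (haarProbability (Matrix.specialUnitaryGroup (Fin N) ℂ)).real
        {V : Matrix.specialUnitaryGroup (Fin N) ℂ | ‖(V : Matrix (Fin N) (Fin N) ℂ) - 1‖ ≤ (j : ℝ)⁻¹} * (j : ℝ) ^ (N ^ 2 - 1) := by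
  haveI : NeZero N := ⟨by omega⟩
  have hN0 : (0 : ℝ) < N := Nat.cast_pos.2 (Nat.pos_of_ne_zero (NeZero.ne N))
  have hN1 : (1 : ℝ) ≤ N := by exact_mod_cast Nat.pos_of_ne_zero (NeZero.ne N)
  have hsN : 0 < Real.sqrt N := Real.sqrt_pos.2 hN0
  have hsNN : Real.sqrt N ≤ N := by
    have h := Real.sqrt_le_sqrt (show (N : ℝ) ≤ N ^ 2 by nlinarith)
    rwa [Real.sqrt_sq hN0.le] at h
  obtain ⟨δ₀, hδ₀, hin⟩ := chart_image_cylinder_subset_tube (N := N) hε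
  obtain ⟨r₀, hr₀, hκ⟩ := exists_kappa_pow_le (N := N) hη
  -- `j ≥ j₀` with `(1 + π)/j ≤ min δ₀ (min r₀ (1/2))`
  set b : ℝ := min δ₀ (min r₀ (1 / 2)) with hb
  have hb0 : 0 < b := by positivity
  obtain ⟨j₀, hj₀⟩ := exists_nat_gt ((1 + π) / b)
  filter_upwards [eventually_ge_atTop j₀, eventually_gt_atTop 0] with j hj hjpos
  have hjr : (0 : ℝ) < j := Nat.cast_pos.2 hjpos
  set δ : ℝ := (j : ℝ)⁻¹ with hδ
  set t : ℝ := π / j with ht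
  have hδpos : 0 < δ := by rw [hδ]; positivity
  have htnn : 0 ≤ t := by rw [ht]; positivity
  have hR : δ + t = (1 + π) / j := by rw [hδ, ht]; field_simp
  have hRb : δ + t ≤ b := by
    rw [hR, div_le_iff₀ hjr]
    have h1 : (1 + π) / b < j := lt_of_lt_of_le hj₀ (by exact_mod_cast hj)
    rw [div_lt_iff₀ hb0] at h1
    linarith
  have hRδ₀ : δ + t ≤ δ₀ := hRb.trans (min_le_left _ _)
  have hRr₀ : δ + t ≤ r₀ := hRb.trans ((min_le_right _ _).trans (min_le_left _ _))
  have hRhalf : δ + t ≤ 1 / 2 := hRb.trans ((min_le_right _ _).trans (min_le_right _ _))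
  have hRpos : 0 < δ + t := by linarith
  -- B0 and the inner squeeze
  have hB0 := haar_sball_eq_mul_haar_centredTube (N := N) hjpos δ
  have htj : π / (j : ℝ) = t := rfl
  rw [htj] at hB0
  have hsub := hin δ t hδpos htnn hRδ₀
  set Cyl := {x : 𝔼 N | ‖x - (imTrace N x / N) • unskew ((I : ℂ) • (1 : Matrix (Fin N) (Fin N) ℂ))‖ ≤ δ - ε * (δ + t) ∧
      imTrace N x / N ∈ Set.Ioc (-(t / N) + ε * (δ + t)) (t / N - ε * (δ + t))} with hCyl
  -- the shrunken cylinder lies in the ball of radius `δ + t`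
  have hρ : 0 ≤ δ - ε * (δ + t) := by
    rw [hδ, ht] at *
    have : ε * ((j : ℝ)⁻¹ + π / j) = ε * (1 + π) / j := by field_simp
    rw [this, sub_nonneg, div_le_iff₀ hjr, inv_mul_cancel₀ hjr.ne']
    exact hε1
  have hball : Cyl ⊆ closedBall (0 : 𝔼 N) (δ + t) := by
    refine (cylinder_subset_closedBall (N := N) (ρ := δ - ε * (δ + t)) (T := t / N) (J := Ioc (-(t / N) + ε * (δ + t)) (t / N - ε * (δ + t)))
      (fun s hs => abs_le.2 ⟨?_, ?_⟩)).trans (closedBall_subset_closedBall ?_)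
    · have : 0 ≤ ε * (δ + t) := by positivity
      linarith [hs.1]
    · have : 0 ≤ ε * (δ + t) := by positivity
      linarith [hs.2]
    · have h1 : Real.sqrt N * (t / N) ≤ N * (t / N) := mul_le_mul_of_nonneg_right hsNN (div_nonneg htnn hN0.le)
      have h2 : (N : ℝ) * (t / N) = t := by field_simp
      have h3 : 0 ≤ ε * (δ + t) := by positivity
      linarith
  have hchain : lowerConst N (δ + t) * volume Cyl ≤ haarProbability (𝔾 N) {u : 𝔾 N |
        ‖((specialPart u : Matrix.specialUnitaryGroup (Fin N) ℂ) : Matrix (Fin N) (Fin N) ℂ) - 1‖ ≤ δ ∧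
          arg (u : Matrix (Fin N) (Fin N) ℂ).det ∈ Set.Ioc (-t) t} :=
    calc lowerConst N (δ + t) * volume Cyl ≤ chartMeasure N Cyl := le_chartMeasure_of_subset hRpos hRhalf hball
      _ = haarProbability (𝔾 N) (chart '' Cyl) := chartMeasure_apply Cyl
      _ ≤ _ := measure_mono hsub
  -- the volume of the shrunken cylinder, real form
  have hvol := volume_cylinder_toReal (N := N) hN hρ (J' := Ioc (Real.sqrt N * (-(t / N) + ε * (δ + t))) (Real.sqrt N * (t / N - ε * (δ + t))))
    (fun s => mem_Ioc_iff_sqrt_mul _ _ s) measurableSet_Ioc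
  have hlenj : Real.sqrt N * (t / N - ε * (δ + t)) - Real.sqrt N * (-(t / N) + ε * (δ + t)) = 2 * Real.sqrt N * (π / N - ε * (1 + π)) / j := by
    rw [ht, hδ]; field_simp; ring
  have hlen0 : 0 ≤ Real.sqrt N * (t / N - ε * (δ + t)) - Real.sqrt N * (-(t / N) + ε * (δ + t)) := by
    rw [hlenj]; have : 0 ≤ π / N - ε * (1 + π) := by linarith
    positivity
  rw [Real.volume_Ioc, ENNReal.toReal_ofReal hlen0] at hvol
  -- pass to reals
  have hfin : haarProbability (𝔾 N) {u : 𝔾 N |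
        ‖((specialPart u : Matrix.specialUnitaryGroup (Fin N) ℂ) : Matrix (Fin N) (Fin N) ℂ) - 1‖ ≤ δ ∧
          arg (u : Matrix (Fin N) (Fin N) ℂ).det ∈ Set.Ioc (-t) t} ≠ ∞ := measure_ne_top _ _
  have hreal := ENNReal.toReal_mono hfin hchain
  rw [ENNReal.toReal_mul, hvol] at hreal
  have hLC : (lowerConst N (δ + t)).toReal = (haarChartConst N : ℝ) / κ (δ + t) ^ (N * N) := by
    rw [Literature.MathematicalPhysics.QuantumFieldTheory.UnitaryCayley.lowerConst, ENNReal.toReal_mul, ENNReal.toReal_inv,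
      ENNReal.toReal_ofReal (pow_nonneg (κ_pos hRpos.le).le _), ENNReal.coe_toReal]
    field_simp
  rw [hLC] at hreal
  -- `c_N/(1+η) ≤ c_N/κ^{N²}`
  have hκj : κ (δ + t) ^ (N * N) ≤ 1 + η := hκ (δ + t) hRpos.le hRr₀
  have hκpos : 0 < κ (δ + t) ^ (N * N) := pow_pos (κ_pos hRpos.le) _
  have hc0 : 0 ≤ (haarChartConst N : ℝ) := NNReal.coe_nonneg _
  have hdens : (haarChartConst N : ℝ) / (1 + η) ≤ (haarChartConst N : ℝ) / κ (δ + t) ^ (N * N) :=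
    div_le_div_of_nonneg_left hc0 hκpos hκj
  -- assemble
  rw [measureReal_def, hB0, ENNReal.toReal_mul, ENNReal.toReal_natCast]
  have hn : N ^ 2 - 1 = N * N - 1 := by rw [sq]
  rw [hn]
  have hρj : δ - ε * (δ + t) = (1 - ε * (1 + π)) / j := by rw [hδ, ht]; field_simp
  rw [hlenj, hρj, div_pow] at hreal
  have hjn : (0 : ℝ) < (j : ℝ) ^ (N * N - 1) := pow_pos hjr _
  have hX : 0 ≤ 2 * Real.sqrt N * (π / N - ε * (1 + π)) := by
    have : 0 ≤ π / N - ε * (1 + π) := by linarith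
    positivity
  calc (haarChartConst N : ℝ) / (1 + η) * (2 * Real.sqrt N * (π / N - ε * (1 + π))) *
          ((1 - ε * (1 + π)) ^ (N * N - 1) * (Real.sqrt π ^ (N * N - 1) / Real.Gamma ((N * N - 1 : ℕ) / 2 + 1)))
      = (j : ℝ) * ((haarChartConst N : ℝ) / (1 + η) * (2 * Real.sqrt N * (π / N - ε * (1 + π)) / j *
          ((1 - ε * (1 + π)) ^ (N * N - 1) / (j : ℝ) ^ (N * N - 1) * (Real.sqrt π ^ (N * N - 1) / Real.Gamma ((N * N - 1 : ℕ) / 2 + 1))))) *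
          (j : ℝ) ^ (N * N - 1) := by field_simp
    _ ≤ (j : ℝ) * ((haarChartConst N : ℝ) / κ (δ + t) ^ (N * N) * (2 * Real.sqrt N * (π / N - ε * (1 + π)) / j *
          ((1 - ε * (1 + π)) ^ (N * N - 1) / (j : ℝ) ^ (N * N - 1) * (Real.sqrt π ^ (N * N - 1) / Real.Gamma ((N * N - 1 : ℕ) / 2 + 1))))) *
          (j : ℝ) ^ (N * N - 1) := by gcongr
    _ ≤ (j : ℝ) * (haarProbability (𝔾 N) {u : 𝔾 N |
          ‖((specialPart u : Matrix.specialUnitaryGroup (Fin N) ℂ) : Matrix (Fin N) (Fin N) ℂ) - 1‖ ≤ δ ∧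
            arg (u : Matrix (Fin N) (Fin N) ℂ).det ∈ Set.Ioc (-t) t}).toReal * (j : ℝ) ^ (N * N - 1) := by gcongr

/-! ## §5 The constant: `C₀(SU(N)) = c_N · (2π∕√N) · ω_{N²−1}` -/

/-- **ANY LIMIT CONSTANT EQUALS `c_N · (2π∕√N) · ω_{N²−1}`** (`N ≥ 2`): if `Haar_{SU(N)}{‖V − 1‖ ≤ η}∕η^{N²−1} → C₀` as `η → 0⁺` then
`C₀ = c_N · (2√N·π∕N) · (√π)^{N²−1}∕Γ((N²−1)∕2 + 1)`. [folklore] -/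
theorem haar_sball_const_eq (hN : 2 ≤ N) {C₀ : ℝ}
    (h : Tendsto (fun η : ℝ => (haarProbability (Matrix.specialUnitaryGroup (Fin N) ℂ)).real
      {V : Matrix.specialUnitaryGroup (Fin N) ℂ | ‖(V : Matrix (Fin N) (Fin N) ℂ) - 1‖ ≤ η} / η ^ (N ^ 2 - 1)) (𝓝[>] 0) (𝓝 C₀)) :
    C₀ = (haarChartConst N : ℝ) * (2 * Real.sqrt N * (π / N)) * (Real.sqrt π ^ (N * N - 1) / Real.Gamma ((N * N - 1 : ℕ) / 2 + 1)) := by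
  haveI : NeZero N := ⟨by omega⟩
  have hN0 : (0 : ℝ) < N := Nat.cast_pos.2 (Nat.pos_of_ne_zero (NeZero.ne N))
  have hπN : 0 < π / N := div_pos Real.pi_pos hN0
  set c : ℝ := (haarChartConst N : ℝ) with hc
  set ω : ℝ := Real.sqrt π ^ (N * N - 1) / Real.Gamma ((N * N - 1 : ℕ) / 2 + 1) with hω
  have hseq := tendsto_seq_of_tendsto h
  -- the upper and lower envelopes as functions of `ε`, continuous at `0` with the common value
  set U : ℝ → ℝ := fun ε => c * (2 * Real.sqrt N * (π / N + ε * (1 + π))) * ((1 + ε * (1 + π)) ^ (N * N - 1) * ω) with hU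
  set L : ℝ → ℝ := fun ε => c / (1 + ε) * (2 * Real.sqrt N * (π / N - ε * (1 + π))) * ((1 - ε * (1 + π)) ^ (N * N - 1) * ω) with hL
  have hU0 : U 0 = c * (2 * Real.sqrt N * (π / N)) * ω := by simp only [hU]; ring
  have hL0 : L 0 = c * (2 * Real.sqrt N * (π / N)) * ω := by simp only [hL]; ring_nf
  have hUc : Tendsto U (𝓝[>] 0) (𝓝 (U 0)) := by
    refine ((Continuous.tendsto ?_ 0).mono_left nhdsWithin_le_nhds)
    simp only [hU]; fun_prop
  have hLc : Tendsto L (𝓝[>] 0) (𝓝 (L 0)) := by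
    refine ((ContinuousAt.tendsto ?_).mono_left nhdsWithin_le_nhds)
    simp only [hL]
    have h1 : ContinuousAt (fun ε : ℝ => c / (1 + ε)) 0 := by
      refine ContinuousAt.div continuousAt_const (by fun_prop) (by norm_num)
    exact ((h1.mul (by fun_prop)).mul (by fun_prop))
  -- `C₀ ≤ U ε` and `L ε ≤ C₀` for all small `ε > 0`
  have hup : ∀ᶠ ε in 𝓝[>] (0 : ℝ), C₀ ≤ U ε := by
    filter_upwards [self_mem_nhdsWithin] with ε hε
    exact le_of_tendsto hseq (by simpa only [hU] using seq_le_eventually hN hε)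
  have hlow : ∀ᶠ ε in 𝓝[>] (0 : ℝ), L ε ≤ C₀ := by
    have hsmall : ∀ᶠ ε in 𝓝[>] (0 : ℝ), ε * (1 + π) < min 1 (π / N) := by
      have hc' : Tendsto (fun ε : ℝ => ε * (1 + π)) (𝓝[>] 0) (𝓝 0) := by
        have : Tendsto (fun ε : ℝ => ε * (1 + π)) (𝓝 0) (𝓝 (0 * (1 + π))) := tendsto_id.mul_const _
        rw [zero_mul] at this
        exact this.mono_left nhdsWithin_le_nhds
      exact hc'.eventually (gt_mem_nhds (by positivity))
    filter_upwards [self_mem_nhdsWithin, hsmall] with ε hε hε'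
    have h1 : ε * (1 + π) ≤ 1 := (hε'.trans_le (min_le_left _ _)).le
    have h2 : ε * (1 + π) < π / N := hε'.trans_le (min_le_right _ _)
    exact ge_of_tendsto hseq (by simpa only [hL] using le_seq_eventually hN hε h1 h2 hε)
  have h1 : C₀ ≤ U 0 := ge_of_tendsto hUc hup
  have h2 : L 0 ≤ C₀ := le_of_tendsto hLc hlow
  rw [hU0] at h1; rw [hL0] at h2
  linarith

/-- **THE SMALL-BALL CONSTANT OF `SU(N)`, EVERY `N ≥ 2`**: `Haar_{SU(N)}{‖V − 1‖_HS ≤ η} ∕ η^{N²−1} → c_N · (2√N π∕N) · (√π)^{N²−1}∕Γ((N²−1)∕2 + 1)` as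
`η → 0⁺`, `c_N = haarChartConst N` the tree's VALUED `U(N)` density. [folklore] -/
theorem tendsto_haar_sball_div_pow_const (hN : 2 ≤ N) :
    Tendsto (fun η : ℝ => (haarProbability (Matrix.specialUnitaryGroup (Fin N) ℂ)).real
      {V : Matrix.specialUnitaryGroup (Fin N) ℂ | ‖(V : Matrix (Fin N) (Fin N) ℂ) - 1‖ ≤ η} / η ^ (N ^ 2 - 1)) (𝓝[>] 0)
      (𝓝 ((haarChartConst N : ℝ) * (2 * Real.sqrt N * (π / N)) * (Real.sqrt π ^ (N * N - 1) / Real.Gamma ((N * N - 1 : ℕ) / 2 + 1)))) := by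
  obtain ⟨C₀, -, h⟩ := exists_tendsto_haar_sball_div_pow (N := N)
  rwa [haar_sball_const_eq hN h] at h

/-- **THE SMALL-BALL CONSTANT OF `SU(N)` IN CLOSED FORM** (`N ≥ 2`):
`Haar_{SU(N)}{‖V − 1‖_HS ≤ η} ∕ η^{N²−1} → (∏_{j<N} j! ∕ (2π)^{N(N+1)∕2}) · (2√N π∕N) · (√π)^{N²−1}∕Γ((N²−1)∕2 + 1)`
(`UnitaryColumn.haarChartConst_eq`; equivalently `vol B^{N²−1}(0,1) ∕ vol_HS SU(N)` with `vol_HS SU(N) = √N (2π)^{(N²+N−2)∕2}∕∏_{j<N} j!`). [folklore] -/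
theorem tendsto_haar_sball_div_pow_valued (hN : 2 ≤ N) :
    Tendsto (fun η : ℝ => (haarProbability (Matrix.specialUnitaryGroup (Fin N) ℂ)).real
      {V : Matrix.specialUnitaryGroup (Fin N) ℂ | ‖(V : Matrix (Fin N) (Fin N) ℂ) - 1‖ ≤ η} / η ^ (N ^ 2 - 1)) (𝓝[>] 0)
      (𝓝 ((∏ j ∈ Finset.range N, (j.factorial : ℝ)) / (2 * π) ^ (N * (N + 1) / 2) * (2 * Real.sqrt N * (π / N)) *
        (Real.sqrt π ^ (N * N - 1) / Real.Gamma ((N * N - 1 : ℕ) / 2 + 1)))) := by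
  rw [← haarChartConst_eq N]; exact tendsto_haar_sball_div_pow_const hN

/-- **CROSS-CHECK AT `N = 2`**: the valued constant is `1∕(3√2·π)` — file 36's `asymptotic_const_SU2_eq` (V40a's cap law) by an independent route. [folklore] -/
theorem const_two_eq :
    (∏ j ∈ Finset.range 2, (j.factorial : ℝ)) / (2 * π) ^ (2 * (2 + 1) / 2) * (2 * Real.sqrt 2 * (π / 2)) *
        (Real.sqrt π ^ (2 * 2 - 1) / Real.Gamma ((2 * 2 - 1 : ℕ) / 2 + 1)) = 1 / (3 * Real.sqrt 2 * π) := by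
  have hΓ : Real.Gamma ((2 * 2 - 1 : ℕ) / 2 + 1) = 3 / 4 * Real.sqrt π := by
    have h1 : ((2 * 2 - 1 : ℕ) : ℝ) / 2 + 1 = 3 / 2 + 1 := by norm_num
    rw [h1, Real.Gamma_add_one (by norm_num), show (3 : ℝ) / 2 = 1 / 2 + 1 by norm_num, Real.Gamma_add_one (by norm_num),
      Real.Gamma_one_half_eq]
    ring
  have hπ : Real.sqrt π ^ (2 * 2 - 1) = π * Real.sqrt π := by
    rw [show 2 * 2 - 1 = 3 by norm_num, pow_succ, Real.sq_sqrt Real.pi_pos.le]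
  have h2 : Real.sqrt 2 * Real.sqrt 2 = 2 := Real.mul_self_sqrt (by norm_num)
  have hsπ : 0 < Real.sqrt π := Real.sqrt_pos.2 Real.pi_pos
  have hs2 : 0 < Real.sqrt 2 := Real.sqrt_pos.2 (by norm_num)
  rw [hΓ, hπ]
  simp only [Finset.prod_range_succ, Finset.prod_range_zero, Nat.factorial_zero, Nat.factorial_one, Nat.cast_one, one_mul,
    show 2 * (2 + 1) / 2 = 3 by norm_num]
  field_simp
  nlinarith [h2, Real.pi_pos, hsπ, hs2]

/-- **THE VALUE AT `N = 3`** (`SU(3)`, `dim = 8`): `C₀(SU(3)) = 2∕(2π)^6 · (2√3·π∕3) · π^4∕Γ(5) = 1∕(384·√3·π)`. [folklore] -/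
theorem const_three_eq :
    (∏ j ∈ Finset.range 3, (j.factorial : ℝ)) / (2 * π) ^ (3 * (3 + 1) / 2) * (2 * Real.sqrt 3 * (π / 3)) *
        (Real.sqrt π ^ (3 * 3 - 1) / Real.Gamma ((3 * 3 - 1 : ℕ) / 2 + 1)) = 1 / (384 * Real.sqrt 3 * π) := by
  have hΓ : Real.Gamma ((3 * 3 - 1 : ℕ) / 2 + 1) = 24 := by
    have h1 : ((3 * 3 - 1 : ℕ) : ℝ) / 2 + 1 = (4 : ℕ) + 1 := by norm_num
    rw [h1, Real.Gamma_nat_eq_factorial 4]; norm_num [Nat.factorial]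
  have hπ : Real.sqrt π ^ (3 * 3 - 1) = π ^ 4 := by
    rw [show 3 * 3 - 1 = 2 * 4 by norm_num, pow_mul, Real.sq_sqrt Real.pi_pos.le]
  have h3 : Real.sqrt 3 * Real.sqrt 3 = 3 := Real.mul_self_sqrt (by norm_num)
  have hs3 : 0 < Real.sqrt 3 := Real.sqrt_pos.2 (by norm_num)
  rw [hΓ, hπ]
  simp only [Finset.prod_range_succ, Finset.prod_range_zero, Nat.factorial_zero, Nat.factorial_one, Nat.factorial_two, Nat.cast_one,
    Nat.cast_ofNat, one_mul, show 3 * (3 + 1) / 2 = 6 by norm_num]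
  field_simp
  nlinarith [h3, Real.pi_pos, hs3, pow_pos Real.pi_pos 4]

end Summit.QuantumFields.BalabanUV.T4Continuum.Spine.NE7c.LiveFactorSUNSmallBallConstant
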